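import Summits.CriticalPhenomena.PercolationContinuityZ3.Theorems.AdditiveGluing.Negative.CertPartition

/-!
# `AdditiveGluing` (crux stmt-CriticalPhenomena-4576, route `PercNearOneGluing`):
# the shared-prefix partition search over ALL simple graphs on `Fin n` at density `1/2`
# (infrastructure for the six-vertex certificate `CertIsoSix.lean`)

The `2^{n(n-1)/2}` graphs on `Fin n` are processed by a depth-first search over the vertex pairs
that SHARES the cluster-partition dynamic programme of `CertPartition.lean` along common prefixes
(integer counts; at density `1/2` a present pair is closed or open with equal weight); each graph is
checked from its `≤ Bell(n)` weighted labellings via block bit masks.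
* `stepH`, `goAll`, `agFastAll n` — the search; `checkD` — the count form of the inequality;
* `wcntN_foldl_stepH` — the programme counts, for every test `P`, the sub-configurations `ω` with
  `P (labOfL n ω)` (`labOfL` = gluing from the left, same clusters as `labOf`);
* `goAll_iff`; `checkD_spec` (the counts ARE `cntConn` / `cntConnSet` of `CertChecker.lean`; `checkD`
  also tests the count form of Kozma–Nitzan's Conjecture 1, used in `CertIsoSix.lean`);
  `additiveGluing_half_of_counts` (count inequalities ⇒ the inequality for `bondPercolation G half`);
  `additiveGluing_half_of_agFastAll` — soundness of the full search;
* `agFastAll_five` (`native_decide`) — cross-check of `agAll_five` by an independent algorithm.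
  At `n = 6` the full search (`2^{15}` leaves) exceeds the farm budget; `CertIsoSix.lean` prunes it
  to one leaf per isomorphism class.  Nothing here asserts the crux.
-/

namespace Summit.CriticalPhenomena.PercolationContinuityZ3.Theorems.AdditiveGluing.Negative.Cert

open MeasureTheory
open Literature.Probability.Percolation Literature.Probability.LatticeModels

/-! ### The search (computable) -/

section Checker

/-- Push with coalescing (integer counts). -/
def pushN (e : List ℕ × ℕ) : List (List ℕ × ℕ) → List (List ℕ × ℕ)
  | [] => [e]
  | e' :: d => if e.1 = e'.1 then (e.1, e.2 + e'.2) :: d else e :: e' :: d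

/-- Coalesce adjacent equal states (integer counts). -/
def coalesceN (d : List (List ℕ × ℕ)) : List (List ℕ × ℕ) := d.foldr pushN []

/-- One PRESENT pair at density `1/2`: closed or open with equal weight; keyed merge sort, coalesce. -/
def stepH (d : List (List ℕ × ℕ)) (u v : ℕ) : List (List ℕ × ℕ) :=
  coalesceN ((List.mergeSort ((d ++ d.map fun e => (mergeLab e.1 u v, e.2)).map fun e => (labKey e.1, e))
    (fun a b => Nat.ble a.1 b.1)).map fun ke => ke.2)

/-- Integer `P`-count of a distribution. -/
def wcntN (P : List ℕ → Bool) (d : List (List ℕ × ℕ)) : ℕ := (d.map fun e => if P e.1 then e.2 else 0).sum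

/-- Bit mask of the block of `o` in the labelling `s`. -/
def blockMask (n : ℕ) (s : List ℕ) (o : ℕ) : ℕ :=
  (List.range n).foldr (fun a m => if s.getD a 0 = s.getD o 0 then m ||| 2 ^ a else m) 0

/-- Block masks of all vertices, per weighted state (same shape as the reach tables of `CertChecker`). -/
def maskTabs (n : ℕ) (d : List (List ℕ × ℕ)) : List (List ℕ × ℕ) :=
  d.map fun e => ((List.range n).map (blockMask n e.1), e.2)

/-- Weighted `#{o ↔ b}`. -/
def wcConn (mt : List (List ℕ × ℕ)) (o b : ℕ) : ℕ :=
  (mt.map fun t => if (t.1.getD o 0).testBit b then t.2 else 0).sum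

/-- Weighted `#{o ↔ A}`. -/
def wcConnSet (mt : List (List ℕ × ℕ)) (o Am : ℕ) : ℕ :=
  (mt.map fun t => if (t.1.getD o 0) &&& Am != 0 then t.2 else 0).sum

/-- The count forms of the additive gluing inequality AND of Kozma–Nitzan's Conjecture 1
(`#{o ↔ A} · #{a ↔ b} ≤ #{o ↔ b} · 2^m`) for ONE graph, from its labelling distribution; both are
tested at the same relay `a` (the worst relay serves both). -/
def checkD (n : ℕ) (d : List (List ℕ × ℕ)) : Bool :=
  let mt := maskTabs n d
  let N := (d.map fun e => e.2).sum
  let cm := (List.range n).map fun o => (List.range n).map fun b => wcConn mt o b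
  let am := (List.range n).map fun o => (List.range (2 ^ n)).map fun Am => wcConnSet mt o Am
  (List.range n).all fun o => (List.range n).all fun b => (List.range (2 ^ n)).all fun Am =>
    Am == 0 || (List.range n).any fun a =>
      Am.testBit a &&
        (decide ((am.getD o []).getD Am 0 ≤ (cm.getD o []).getD b 0 + (N - (cm.getD a []).getD b 0)) &&
          decide ((am.getD o []).getD Am 0 * (cm.getD a []).getD b 0 ≤ (cm.getD o []).getD b 0 * N))

/-- Depth-first search over the remaining pairs: absent, or present (one `stepH`). -/
def goAll (n : ℕ) : List (Fin n × Fin n) → List (List ℕ × ℕ) → Bool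
  | [], d => checkD n d
  | p :: ps, d => goAll n ps d && goAll n ps (stepH d p.1 p.2)

/-- THE CHECK: every simple graph on `Fin n` at density `1/2`, every `(o, b, A)`. -/
def agFastAll (n : ℕ) : Bool := goAll n (allPairs n) [(List.range n, 1)]

end Checker

/-! ### Gluing from the left -/

/-- The labelling of a configuration glued from the LEFT (the order in which the search meets the
pairs). -/
def labOfL (n : ℕ) (ω : List (Fin n × Fin n)) : List ℕ :=
  ω.foldl (fun lab p => mergeLab lab p.1 p.2) (List.range n)

/-- Gluing from the left is gluing the reversed list from the right. -/
theorem labOfL_eq_labOf_reverse {n : ℕ} (ω : List (Fin n × Fin n)) :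
    labOfL n ω = labOf n ω.reverse := by rw [labOfL, labOf, List.foldl_eq_foldr_reverse]

/-- `Eset` does not see the order. -/
theorem Eset_reverse {n : ℕ} (ω : List (Fin n × Fin n)) : Eset ω.reverse = Eset ω := by simp [Eset]

/-- Equal left-labels iff joined by an open path. -/
theorem labOfL_getD_eq_iff {n : ℕ} (ω : List (Fin n × Fin n)) (x y : Fin n) :
    (labOfL n ω).getD x 0 = (labOfL n ω).getD y 0 ↔
      (openGraph (↑(Eset ω) : Set (Sym2 (Fin n)))).Reachable x y := by
  rw [labOfL_eq_labOf_reverse, labOf_getD_eq_iff, Eset_reverse]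

/-- Bits of a block mask. -/
theorem testBit_blockMask {n : ℕ} (s : List ℕ) (o : ℕ) {b : ℕ} (hb : b < n) :
    (blockMask n s o).testBit b = true ↔ s.getD b 0 = s.getD o 0 := by
  unfold blockMask
  suffices h : ∀ l : List ℕ, (l.foldr (fun a m => if s.getD a 0 = s.getD o 0 then m ||| 2 ^ a else m) 0).testBit b
      = true ↔ b ∈ l ∧ s.getD b 0 = s.getD o 0 by
    rw [h]; simp [List.mem_range, hb]
  intro l
  induction l with
  | nil => simp
  | cons a l ih =>
    rw [List.foldr_cons]
    by_cases ha : s.getD a 0 = s.getD o 0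
    · rw [if_pos ha, Nat.testBit_or, Bool.or_eq_true, ih, Nat.testBit_two_pow, decide_eq_true_eq,
        List.mem_cons]
      exact ⟨fun h => h.elim (fun ⟨h1, h2⟩ => ⟨Or.inr h1, h2⟩) (fun h => ⟨Or.inl h.symm, h ▸ ha⟩),
        fun ⟨h1, h2⟩ => h1.elim (fun h => Or.inr h.symm) (fun h => Or.inl ⟨h, h2⟩)⟩
    · rw [if_neg ha, ih, List.mem_cons]
      exact ⟨fun ⟨h1, h2⟩ => ⟨Or.inr h1, h2⟩,
        fun ⟨h1, h2⟩ => ⟨h1.resolve_left (fun h => ha (h ▸ h2)), h2⟩⟩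

/-! ### The dynamic programme counts sub-configurations -/

/-- `wcntN` of a cons. -/
theorem wcntN_cons (P : List ℕ → Bool) (e : List ℕ × ℕ) (d : List (List ℕ × ℕ)) :
    wcntN P (e :: d) = (if P e.1 then e.2 else 0) + wcntN P d := by simp [wcntN]

/-- `wcntN` of an append. -/
theorem wcntN_append (P : List ℕ → Bool) (d d' : List (List ℕ × ℕ)) :
    wcntN P (d ++ d') = wcntN P d + wcntN P d' := by simp [wcntN, List.sum_append]

/-- Pushing preserves counts. -/
theorem wcntN_pushN (P : List ℕ → Bool) (e : List ℕ × ℕ) (d : List (List ℕ × ℕ)) :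
    wcntN P (pushN e d) = (if P e.1 then e.2 else 0) + wcntN P d := by
  cases d with
  | nil => simp [pushN, wcntN]
  | cons e' d =>
    simp only [pushN]
    by_cases h : e.1 = e'.1
    · rw [if_pos h, wcntN_cons, wcntN_cons]
      dsimp only
      rw [h]
      split_ifs <;> ring
    · rw [if_neg h, wcntN_cons]

/-- Coalescing preserves counts. -/
theorem wcntN_coalesceN (P : List ℕ → Bool) : ∀ d : List (List ℕ × ℕ), wcntN P (coalesceN d) = wcntN P d
  | [] => rfl
  | e :: d => by
    rw [coalesceN, List.foldr_cons, wcntN_pushN, ← coalesceN, wcntN_coalesceN P d, wcntN_cons]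

/-- Counts of one step: unchanged states plus glued states. -/
theorem wcntN_stepH (P : List ℕ → Bool) (d : List (List ℕ × ℕ)) (u v : ℕ) :
    wcntN P (stepH d u v) = wcntN P d + wcntN (fun s => P (mergeLab s u v)) d := by
  rw [stepH, wcntN_coalesceN]
  have hperm := ((List.mergeSort_perm ((d ++ d.map fun e => (mergeLab e.1 u v, e.2)).map
    fun e => (labKey e.1, e)) (fun a b => Nat.ble a.1 b.1)).map fun ke => ke.2)
  rw [List.map_map] at hperm
  have hid : ((fun ke : ℕ × (List ℕ × ℕ) => ke.2) ∘ fun e : List ℕ × ℕ => (labKey e.1, e)) = id := by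
    funext e; rfl
  rw [hid, List.map_id] at hperm
  unfold wcntN
  rw [(hperm.map _).sum_eq]
  simp only [List.map_append, List.map_map, List.sum_append]
  rfl

/-- **The dynamic programme is exact**: after processing `es` from `d`, the `P`-count is the sum over
the sub-lists `ω` of `es` of the `P ∘ (glue ω from the left)`-counts of `d`. -/
theorem wcntN_foldl_stepH {n : ℕ} : ∀ (es : List (Fin n × Fin n)) (d : List (List ℕ × ℕ)) (P : List ℕ → Bool),
    wcntN P (es.foldl (fun d q => stepH d q.1 q.2) d) =
      (es.sublists'.map fun ω => wcntN (fun s => P (ω.foldl (fun lab p => mergeLab lab p.1 p.2) s)) d).sum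
  | [], d, P => by
    simp only [List.foldl_nil, List.sublists'_nil, List.map_cons, List.map_nil, List.sum_cons, List.sum_nil,
      Nat.add_zero]
  | p :: es, d, P => by
    rw [List.foldl_cons, wcntN_foldl_stepH es, List.sublists'_cons, List.map_append, List.sum_append,
      List.map_map]
    have h : (es.sublists'.map fun ω => wcntN (fun s => P (ω.foldl (fun lab p => mergeLab lab p.1 p.2) s))
        (stepH d p.1 p.2)) = es.sublists'.map fun ω =>
          wcntN (fun s => P (ω.foldl (fun lab p => mergeLab lab p.1 p.2) s)) d +
          wcntN (fun s => P ((p :: ω).foldl (fun lab p => mergeLab lab p.1 p.2) s)) d :=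
      List.map_congr_left fun ω _ => by rw [wcntN_stepH]; rfl
    rw [h, List.sum_map_add]
    rfl

/-- `countP` as a sum of indicators. -/
theorem countP_eq_sum_map_ite {α : Type*} (q : α → Bool) : ∀ l : List α,
    l.countP q = (l.map fun x => if q x then 1 else 0).sum
  | [] => rfl
  | a :: l => by rw [List.countP_cons, countP_eq_sum_map_ite q l, List.map_cons, List.sum_cons, Nat.add_comm]

/-- From the initial state: the `P`-count is the number of sub-lists `ω` with `P (labOfL n ω)`. -/
theorem wcntN_foldl_stepH_init {n : ℕ} (es : List (Fin n × Fin n)) (P : List ℕ → Bool) :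
    wcntN P (es.foldl (fun d q => stepH d q.1 q.2) [(List.range n, 1)]) =
      es.sublists'.countP fun ω => P (labOfL n ω) := by
  rw [wcntN_foldl_stepH, countP_eq_sum_map_ite]
  rfl

/-- The total count is `2^m`. -/
theorem sum_map_snd_foldl_stepH {n : ℕ} (es : List (Fin n × Fin n)) :
    ((es.foldl (fun d q => stepH d q.1 q.2) [(List.range n, 1)]).map fun e => e.2).sum = 2 ^ es.length := by
  have h := wcntN_foldl_stepH_init es fun _ => true
  simp only [wcntN, if_true] at h
  rw [h, ← List.length_sublists' es, List.countP_eq_length_filter, List.filter_true]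

/-! ### `goAll` runs `checkD` on every sub-list -/

/-- `goAll ps d` checks every sub-list of `ps` processed from `d`. -/
theorem goAll_iff {n : ℕ} : ∀ (ps : List (Fin n × Fin n)) (d : List (List ℕ × ℕ)),
    goAll n ps d = true ↔ ∀ es ∈ ps.sublists', checkD n (es.foldl (fun d q => stepH d q.1 q.2) d) = true
  | [], d => by simp [goAll]
  | p :: ps, d => by
    rw [goAll, Bool.and_eq_true, goAll_iff ps d, goAll_iff ps (stepH d p.1 p.2), List.sublists'_cons]
    constructor
    · rintro ⟨h1, h2⟩ es hes
      rcases List.mem_append.1 hes with hes | hes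
      · exact h1 es hes
      · obtain ⟨es', hes', rfl⟩ := List.mem_map.1 hes
        exact h2 es' hes'
    · intro h
      exact ⟨fun es hes => h es (List.mem_append.2 (Or.inl hes)),
        fun es hes => h (p :: es) (List.mem_append.2 (Or.inr (List.mem_map.2 ⟨es, hes, rfl⟩)))⟩

/-! ### The counts of `checkD` are the counts of `CertChecker` -/

/-- High bits of the reach mask are never set. -/
theorem testBit_reachM_eq_false {n M o u : ℕ} (ho : o < n) (hu : n ≤ u) : (reachM n M o).testBit u = false := by
  unfold reachM
  suffices h : ∀ k, ((stepM n M)^[k] (2 ^ o)).testBit u = false from h n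
  intro k
  induction k with
  | zero =>
    rw [Function.iterate_zero, id_eq, Nat.testBit_two_pow]
    exact decide_eq_false (by omega)
  | succ k ih =>
    rw [Function.iterate_succ_apply']
    cases h : (stepM n M ((stepM n M)^[k] (2 ^ o))).testBit u
    · rfl
    · rcases testBit_stepM.1 h with h' | ⟨v, _, _, hrow⟩
      · rw [ih] at h'; exact absurd h' Bool.false_ne_true
      · simp [row, not_lt.2 hu] at hrow

/-- The block mask of `o` and the reach mask of `o` mark the same vertices. -/
theorem testBit_blockMask_labOfL_iff {n : ℕ} (ω : List (Fin n × Fin n)) (o : Fin n) (i : ℕ) :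
    (blockMask n (labOfL n ω) o).testBit i = true ↔ ((reachTable n ω).getD o 0).testBit i = true := by
  by_cases hi : i < n
  · rw [testBit_blockMask _ _ hi, labOfL_getD_eq_iff ω ⟨i, hi⟩ o,
      testBit_reachTable_iff_mem_openConn ω o ⟨i, hi⟩]
    exact ⟨fun h => h.symm, fun h => SimpleGraph.Reachable.symm h⟩
  · rw [reachTable_getD, testBit_reachM_eq_false o.2 (not_lt.1 hi)]
    have : (blockMask n (labOfL n ω) ↑o).testBit i = false := by
      unfold blockMask
      suffices h : ∀ l : List ℕ, (∀ a ∈ l, a < n) →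
          (l.foldr (fun a m => if (labOfL n ω).getD a 0 = (labOfL n ω).getD o 0 then m ||| 2 ^ a else m)
            0).testBit i = false from h _ (fun a ha => List.mem_range.1 ha)
      intro l hl
      induction l with
      | nil => simp
      | cons a l ih =>
        rw [List.foldr_cons]
        have ha : a ≠ i := fun h => hi (h ▸ hl a List.mem_cons_self)
        split_ifs
        · rw [Nat.testBit_or, ih (fun x hx => hl x (List.mem_cons_of_mem _ hx)), Nat.testBit_two_pow]
          simp [ha]
        · exact ih (fun x hx => hl x (List.mem_cons_of_mem _ hx))
    rw [this]

/-- The weighted two-point count of the search is `cntConn`. -/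
theorem wcConn_eq_cntConn {n : ℕ} (es : List (Fin n × Fin n)) (o b : Fin n) :
    wcConn (maskTabs n (es.foldl (fun d q => stepH d q.1 q.2) [(List.range n, 1)])) o b =
      cntConn (tables n es) o b := by
  have h1 : ∀ D : List (List ℕ × ℕ),
      wcConn (maskTabs n D) o b = wcntN (fun s => (blockMask n s o).testBit b) D := by
    intro D
    rw [wcConn, maskTabs, List.map_map, wcntN]
    exact congrArg _ (List.map_congr_left fun e _ => by
      simp only [Function.comp_apply, getD_map_range _ _ o.2])
  rw [h1, wcntN_foldl_stepH_init, cntConn, tables, List.countP_map]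
  exact List.countP_congr fun ω _ => by
    rw [Function.comp_apply]; exact testBit_blockMask_labOfL_iff ω o b

/-- The weighted point-to-set count of the search is `cntConnSet`. -/
theorem wcConnSet_eq_cntConnSet {n : ℕ} (es : List (Fin n × Fin n)) (o : Fin n) (Am : ℕ) :
    wcConnSet (maskTabs n (es.foldl (fun d q => stepH d q.1 q.2) [(List.range n, 1)])) o Am =
      cntConnSet (tables n es) o Am := by
  have h1 : ∀ D : List (List ℕ × ℕ),
      wcConnSet (maskTabs n D) o Am = wcntN (fun s => blockMask n s o &&& Am != 0) D := by
    intro D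
    rw [wcConnSet, maskTabs, List.map_map, wcntN]
    exact congrArg _ (List.map_congr_left fun e _ => by
      simp only [Function.comp_apply, getD_map_range _ _ o.2])
  rw [h1, wcntN_foldl_stepH_init, cntConnSet, tables, List.countP_map]
  exact List.countP_congr fun ω _ => by
    rw [Function.comp_apply, bne_iff_ne, bne_iff_ne, and_ne_zero_iff, and_ne_zero_iff]
    exact exists_congr fun i => by rw [testBit_blockMask_labOfL_iff]

/-- What `checkD n d = true` says for the distribution of a graph (table lookups unfolded). -/
theorem checkD_spec {n : ℕ} {es : List (Fin n × Fin n)}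
    (h : checkD n (es.foldl (fun d q => stepH d q.1 q.2) [(List.range n, 1)]) = true)
    (o b : Fin n) {Am : ℕ} (hAm : Am < 2 ^ n) (hAm0 : Am ≠ 0) :
    ∃ a : Fin n, Am.testBit a = true ∧
      cntConnSet (tables n es) o Am ≤ cntConn (tables n es) o b +
        (2 ^ es.length - cntConn (tables n es) a b) ∧
      cntConnSet (tables n es) o Am * cntConn (tables n es) a b ≤ cntConn (tables n es) o b * 2 ^ es.length := by
  simp only [checkD, List.all_eq_true, List.mem_range, Bool.or_eq_true, beq_iff_eq,
    List.any_eq_true, Bool.and_eq_true, decide_eq_true_eq] at h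
  obtain ⟨a, ha, hta, hle⟩ := (h o o.2 b b.2 Am hAm).resolve_left hAm0
  refine ⟨⟨a, ha⟩, hta, ?_⟩
  rw [getD_map_range _ _ o.2, getD_map_range _ _ hAm, getD_map_range _ _ o.2, getD_map_range _ _ b.2,
    getD_map_range _ _ ha, getD_map_range _ _ b.2, sum_map_snd_foldl_stepH,
    wcConnSet_eq_cntConnSet es o Am, wcConn_eq_cntConn es o b, wcConn_eq_cntConn es ⟨a, ha⟩ b] at hle
  exact hle

/-! ### Soundness of the search -/

/-- From the count inequalities of a graph to the additive gluing inequality at density `1/2`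
(the arithmetic tail of `additiveGluing_half_of_agAll`, isolated). -/
theorem additiveGluing_half_of_counts {n : ℕ} (G : SimpleGraph (Fin n))
    (hcount : ∀ (o b : Fin n) {Am : ℕ}, Am < 2 ^ n → Am ≠ 0 → ∃ a : Fin n, Am.testBit a = true ∧
      cntConnSet (tables n (edgeList G)) o Am ≤ cntConn (tables n (edgeList G)) o b +
        (2 ^ (edgeList G).length - cntConn (tables n (edgeList G)) a b))
    (A : Finset (Fin n)) (o b : Fin n) (t : ℝ) (ht : 0 ≤ t)
    (hrel : ∀ a ∈ A, 1 - t ≤ (bondPercolation G half).real (openConn a b)) :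
    (bondPercolation G half).real (⋃ a ∈ A, openConn o a) - t ≤
      (bondPercolation G half).real (openConn o b) := by
  classical
  set es := edgeList G with hes
  have hnd : (es.map mkE).Nodup := nodup_map_mk_of_sublist (edgeList_sublist G)
  rw [bondPercolation_eq_prodBernoulli_wHalf G] at hrel ⊢
  rw [← hes] at hrel ⊢
  by_cases hA : A = ∅
  · subst hA
    simp only [Finset.notMem_empty, Set.iUnion_of_empty, Set.iUnion_empty, measureReal_empty]
    linarith [measureReal_nonneg (μ := prodBernoulli (wHalf (Eset es))) (s := openConn o b)]
  obtain ⟨a0, ha0⟩ := Finset.nonempty_iff_ne_empty.2 hA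
  have hAm0 : maskL A.toList ≠ 0 := by
    intro h0
    have := (testBit_maskL A.toList a0).2 ⟨a0, Finset.mem_toList.2 ha0, rfl⟩
    rw [h0, Nat.zero_testBit] at this
    exact Bool.false_ne_true this
  obtain ⟨a, hta, hle⟩ := hcount o b (maskL_lt A.toList) hAm0
  have haA : a ∈ A := by
    obtain ⟨a', ha', haa'⟩ := (testBit_maskL A.toList a).1 hta
    rw [← Fin.ext haa']; exact Finset.mem_toList.1 ha'
  rw [real_iUnion_openConn_eq hnd, real_openConn_eq hnd]
  have hrel' := hrel a haA
  rw [real_openConn_eq hnd] at hrel'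
  have hN : (0 : ℝ) < 2 ^ es.length := by positivity
  have hcab := cntConn_le es a b
  have hcast : (cntConnSet (tables n es) o (maskL A.toList) : ℝ) ≤
      cntConn (tables n es) o b + ((2 : ℝ) ^ es.length - cntConn (tables n es) a b) := by
    have h' : ((cntConnSet (tables n es) o (maskL A.toList) : ℕ) : ℝ) ≤
        ((cntConn (tables n es) o b + (2 ^ es.length - cntConn (tables n es) a b) : ℕ) : ℝ) := by
      exact_mod_cast hle
    rw [Nat.cast_add, Nat.cast_sub hcab, Nat.cast_pow] at h'
    simpa using h'
  have h1 : (2 : ℝ) ^ es.length - cntConn (tables n es) a b ≤ t * 2 ^ es.length := by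
    rw [le_div_iff₀ hN] at hrel'
    linarith
  have key : (cntConnSet (tables n es) o (maskL A.toList) : ℝ) / 2 ^ es.length ≤
      (cntConn (tables n es) o b : ℝ) / 2 ^ es.length + t := by
    calc (cntConnSet (tables n es) o (maskL A.toList) : ℝ) / 2 ^ es.length
        ≤ ((cntConn (tables n es) o b : ℝ) + t * 2 ^ es.length) / 2 ^ es.length :=
          div_le_div_of_nonneg_right (by linarith) hN.le
      _ = (cntConn (tables n es) o b : ℝ) / 2 ^ es.length + t := by
          rw [add_div, mul_div_assoc, div_self hN.ne', mul_one]
  linarith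

/-- **Soundness of the search.** If `agFastAll n = true` then the additive gluing inequality holds
for `bondPercolation G half` on EVERY simple graph `G` on `Fin n`, all `A o b t`. -/
theorem additiveGluing_half_of_agFastAll {n : ℕ} (h : agFastAll n = true) (G : SimpleGraph (Fin n))
    (A : Finset (Fin n)) (o b : Fin n) (t : ℝ) (ht : 0 ≤ t)
    (hrel : ∀ a ∈ A, 1 - t ≤ (bondPercolation G half).real (openConn a b)) :
    (bondPercolation G half).real (⋃ a ∈ A, openConn o a) - t ≤
      (bondPercolation G half).real (openConn o b) := by
  have hd := (goAll_iff (allPairs n) _).1 h (edgeList G) (List.mem_sublists'.2 (edgeList_sublist G))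
  exact additiveGluing_half_of_counts G (fun o b _ hAm hAm0 =>
    (checkD_spec hd o b hAm hAm0).imp fun a ha => ⟨ha.1, ha.2.1⟩) A o b t ht hrel

/-! ### Cross-check at five vertices -/

/-- `agFastAll 5 = true` (`native_decide`): the shared-prefix partition search agrees with the
configuration enumeration of `CertSoundness.lean` (`agAll_five`) that every simple graph on five
vertices passes. -/
theorem agFastAll_five : agFastAll 5 = true := by native_decide

end Summit.CriticalPhenomena.PercolationContinuityZ3.Theorems.AdditiveGluing.Negative.Cert
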